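import Literature.MathematicalPhysics.QuantumFieldTheory.Balaban1983to89.B9Eq343BlockPartitionOfUnity
import Literature.MathematicalPhysics.QuantumFieldTheory.Balaban1983to89.B9Eq316TowerFlatIsOneStep
import Mathlib.Analysis.SpecialFunctions.Pow.Real

/-!
# `Balaban1983to89.B9Eq343BlockLocalisedHolderPieces` — T. Bałaban, *Propagators for lattice gauge theories in a background field*, Commun. Math. Phys. **99** (1985)
# 389–434 [Balaban1985BackgroundPropagators] (3.40) p. 397 (the η-scale Hölder quotients `|x′ − x|^{−α}|… A(x′) − A(x)|`, `|x − x′| ≦ 1`), (3.43) p. 398 (*«ζ ∈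
# C₀^∞(Δ̃(y))»*), (3.44) p. 398 (*«supp λ ⊂ Δ̃(y′)»* — the second-order member takes BLOCK-LOCALISED Hölder inputs): **THE LOCALISATION STEP OF STOREY H — a field
# `ω` on the fine torus with a WEIGHTED value row `N·e^{−δ d_m(Πx,v)}` and a WEIGHTED η-scale Hölder row `H·e^{−δ d_m(Πx,v)}·(dist(x,x′)∕K)^ε` (`dist ≤ K`) splits as
# `ω = Σ_y ζ_y·ω` over the block partition of unity of `B9Eq343BlockPartitionOfUnity`, each piece supported in the blocks at coarse distance `≤ 1` from `y`, with
# value row `N·e^{δ}·e^{−δ d_m(y,v)}` and Hölder row `(H + d·N)·e^{2δ}·e^{−δ d_m(y,v)}·(dist∕K)^ε`** — exactly the input class of print's (3.44) at `y′ = y`, with the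
# decay in `y` that re-sums to a row centred at `v`; plus the two geometric facts it rests on (η-close pairs lie in adjacent blocks; `tdist` is invariant under
# `siteCast`); NE9 crux-team LEAF PROVER 01, gen 92

statement-level skeleton of published theorems with citation tags; proofs where landed; nothing here is a claim about the Yang–Mills mass gap

CITATION HEADER (lean-in-tree rule).  Audit cell `pub-balaban`, sub-cell `t4`, BINDER row NE9; filed by NE9 crux-team LEAF PROVER 01 (`b2b-balaban-t4-ne9-formalise-leaf-01`,
gen 92; bears_on: R4/N22).  Source READ first-hand this generation (`paper:balaban1985-cmp99-background-propagators`, journal page = PDF page + 388): p. 397 (3.39)–(3.41), p. 398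
(3.43)–(3.45).  BY NAME: this lineage's (P) `B9Eq343BlockPartitionOfUnity` (`blockPartition`, `sum_blockPartition`, `blockPartition_nonneg ∕ _le_one`,
`abs_blockPartition_sub_le`, `tdist_blockCoord_le_one_of_blockPartition_ne_zero`, `blockIndex_add_natCast_of_lt`), `B4Sect5Torus.tdist ∕ ccoord ∕ circAbs_le_tdist`,
`B4TorusKernel.MultiPeriod.abs_add_mul_centre`, `B9Eq316TowerFlatIsOneStep.siteCast`, Mathlib's `Real.rpow`.  A MODEL READING, declared: the Hölder quotients use PLAIN
differences `ω(x′) − ω(x)` (print's (3.40) transports along `Γ_{x,x′}`; on the cell's small-gauge model the two differ by `≤ (e^{α} − 1)·|ω|` per unit distance — a value-row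
term — so either reading of the displayed letters of STOREY H implies the other up to constants; not proved here).

WHAT IS PROVED (sorry-free; proof lane — 0 `def`; [folklore]).
* §1 **`tdist_siteCast`** (`tdist` under the identity-of-the-lattice cast), **`blockIndex_add_natCast_of_le`** ((P)'s shift lemma up to `s = K`),
  **`tdist_blockCoord_le_one_of_tdist_le`** — `dist_{T_{(Km)}}(x, x′) ≤ K ⟹ dist_{T_m}(Π(x), Π(x′)) ≤ 1` (η-close pairs lie in adjacent blocks; the centred representative
  of `abs_add_mul_centre` walked coordinatewise).
* §2 **`localised_pieces`** — the four properties (a) `Σ_y ζ_y·ω = ω`, (b) support, (c) value row, (d) η-scale Hölder row of the pieces, for `ε ≤ 1` and `δ ≥ 0`, on ANY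
  fine torus `P = (Km)` through `siteCast` (so that the row files apply it at `towerP L m (n+1)` with `towerP_eq_fineP_pow`).
HONEST SCOPE.  Lattice bookkeeping only — NO propagator, NO estimate of [B9]; the Hölder letters (3.43)₂∕(3.44) for `G′_k(U)` and the junction with the third word of `𝔊̃_k`
(this lineage's G-1 `B9Eq3152GtildeThirdWordTwoSided`, G-3 `B11Eq117FrakGkPiTransformationNorm`) are NOT here; «NE9 ⇐ the named binders»; NE9 NOT PRINTED ∕ NOT PROVED; row
WALLED ON A MODEL (O-NE9-1; #5 UNRULED); spine PROVED 0∕9; rung (B)+1 on a finite T⁴ — NOT infinite volume, NOT mass gap, NOT BetaPertH, NOT Clay.  HONEST DEPENDENCY: continuum YM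
on T⁴ ⇐ BetaPertH ∧ nine spine estimates (0/9 proved); BetaPertH ⇐ (D1) ∧ (D4) ∧ CAP+tail; G-an2-4 gates asym, D1 and NE2/3/4.  NEW file importing (P) and
`B9Eq316TowerFlatIsOneStep`; nothing modified.  Net new unproved facts: 0.
-/

noncomputable section

set_option autoImplicit false

open scoped BigOperators

namespace Literature.MathematicalPhysics.QuantumFieldTheory.Balaban1983to89.B9Eq343BlockLocalisedHolderPieces

open Fin.NatCast Fin.CommRing
open B4Sect5Torus (TSite tdist ccoord tdist_nonneg tdist_triangle tdist_symm ccoord_cast)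
open B4TorusKernel.MultiPeriod (circAbs centre abs_add_mul_centre circAbs_nonneg circAbs_le_abs circAbs_add_mul)
open B9Eq319QprimeTorus (fineP blockCoord)
open B9Eq316TowerFlatIsOneStep (siteCast siteCast_apply_val)
open B9Eq343BlockPartitionOfUnity (blockIndex blockPartition sum_blockPartition blockPartition_nonneg blockPartition_le_one abs_blockPartition_sub_le
  tdist_blockCoord_le_one_of_blockPartition_ne_zero)

/-! ## §1 The torus distance under a site cast; block distance of η-close pairs -/

section Geometry

variable {d : ℕ}

/-- The torus distance is invariant under the identity-of-the-lattice cast `siteCast` (coordinates are preserved). [folklore]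
[cite: Balaban1985Averaging, (1)–(2) p.17] -/
theorem tdist_siteCast {P P' : Fin d → ℕ} (h : P = P') (x x' : TSite d P) : tdist P' (siteCast h x) (siteCast h x') = tdist P x x' := by
  subst h; rfl

variable (K M : ℕ) [NeZero K] [NeZero M]

/-- **A shift by `s ≤ K` moves the block index by at most one** (mod `M`): `⌊(u + s)∕K⌋ ∈ {⌊u∕K⌋, ⌊u∕K⌋ + 1}` in `ℤ_M` — the `s < K` case is
`B9Eq343BlockPartitionOfUnity.blockIndex_add_natCast_of_lt`; at `s = K` the index moves by exactly one. [folklore] [cite: Balaban1985Averaging, (2) p.17] -/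
theorem blockIndex_add_natCast_of_le (u : Fin (K * M)) {s : ℕ} (hs : s ≤ K) :
    blockIndex K M (u + (s : Fin (K * M))) = blockIndex K M u ∨ blockIndex K M (u + (s : Fin (K * M))) = blockIndex K M u + 1 := by
  rcases lt_or_eq_of_le hs with hlt | heq
  · exact B9Eq343BlockPartitionOfUnity.blockIndex_add_natCast_of_lt K M u hlt
  · -- `s = K`
    rw [heq]
    rcases Nat.lt_or_ge 1 M with hM | hM
    · right
      have hK : 0 < K := Nat.pos_of_ne_zero (NeZero.ne K)
      have hKM : K < K * M := by nlinarith
      have hsval : ((K : Fin (K * M)) : ℕ) = K := Fin.val_cast_of_lt hKM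
      set q : ℕ := (u : ℕ) / K with hq
      set r : ℕ := (u : ℕ) % K with hr
      have hu : (u : ℕ) = K * q + r := (Nat.div_add_mod (u : ℕ) K).symm
      have hrK : r < K := Nat.mod_lt _ hK
      have hqM : q < K * M / K := Nat.div_lt_div_of_lt_of_dvd (Dvd.intro _ rfl) u.isLt
      rw [Nat.mul_div_cancel_left M hK] at hqM
      have hblku : (blockIndex K M u : ℕ) = q := rfl
      have e1 : blockIndex K M u + 1 = ((q + 1 : ℕ) : Fin M) := by rw [Nat.cast_succ, ← hblku, Fin.cast_val_eq_self]
      have hval : ((u + (K : Fin (K * M)) : Fin (K * M)) : ℕ) = ((u : ℕ) + K) % (K * M) := by rw [Fin.val_add, hsval]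
      rw [e1]; ext
      show ((u + (K : Fin (K * M)) : Fin (K * M)) : ℕ) / K = (((q + 1 : ℕ) : Fin M) : ℕ)
      rw [hval, Fin.val_natCast]
      by_cases hw : (u : ℕ) + K < K * M
      · rw [Nat.mod_eq_of_lt hw, hu, show K * q + r + K = K * (q + 1) + r by ring, Nat.mul_add_div hK, Nat.div_eq_of_lt hrK, add_zero]
        have : q + 1 < M := by
          by_contra hc
          have hq1 : M ≤ q + 1 := Nat.le_of_not_lt hc
          have : K * M ≤ K * (q + 1) := Nat.mul_le_mul_left K hq1
          rw [hu] at hw; nlinarith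
        rw [Nat.mod_eq_of_lt this]
      · push Not at hw
        have hlt2 : (u : ℕ) + K < K * M + K := by have := u.isLt; omega
        rw [Nat.mod_eq_sub_mod hw, Nat.mod_eq_of_lt (by omega), Nat.div_eq_of_lt (by omega)]
        have hq1 : q + 1 = M := by
          have h1 : K * M ≤ K * q + r + K := by rw [hu] at hw; exact hw
          have h2 : K * M < K * (q + 2) := by nlinarith
          have h3 : M < q + 2 := Nat.lt_of_mul_lt_mul_left h2
          omega
        rw [hq1, Nat.mod_self]
    · -- `M = 1`: one block
      have hM1 : M = 1 := le_antisymm hM (Nat.one_le_iff_ne_zero.2 (NeZero.ne M))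
      left; subst hM1; exact Subsingleton.elim _ _

/-- **η-CLOSE PAIRS LIE IN ADJACENT BLOCKS**: on the fine torus `T_{(Km)}`, `dist(x, x′) ≤ K` (η-distance `≤ 1`) implies `dist_{T_m}(Π(x), Π(x′)) ≤ 1`. [folklore]
[cite: Balaban1985BackgroundPropagators, (3.40) p.397; Balaban1985Averaging, (2) p.17] -/
theorem tdist_blockCoord_le_one_of_tdist_le (m : Fin d → ℕ) [∀ i, NeZero (m i)] (hm : ∀ i, 1 ≤ m i) (x x' : TSite d (fineP K m))
    (hxx : tdist (fineP K m) x x' ≤ K) : tdist m (blockCoord K m x) (blockCoord K m x') ≤ 1 := by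
  have hP : ∀ i, 1 ≤ fineP K m i := fun i => Nat.one_le_iff_ne_zero.2 (Nat.mul_ne_zero (NeZero.ne K) (NeZero.ne (m i)))
  unfold tdist
  have h1 : Finset.univ.sup (ccoord m (blockCoord K m x) (blockCoord K m x')) ≤ 1 := by
    refine Finset.sup_le fun i _ => ?_
    -- the coordinate offset `t`, `|t| = dist(x′_i − x_i, KMℤ) ≤ K`
    have hPi : 1 ≤ K * m i := hP i
    set z : ℤ := ((x' i : ℕ) : ℤ) - ((x i : ℕ) : ℤ) with hz
    set t : ℤ := z + (K * m i : ℕ) * centre (K * m i) z with ht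
    have habs : |t| = circAbs (K * m i) z := abs_add_mul_centre hPi z
    have htK : t.natAbs ≤ K := by
      have h1 : (circAbs (K * m i) z : ℝ) ≤ tdist (fineP K m) x' x := B4Sect5Torus.circAbs_le_tdist hP x' x i
      rw [tdist_symm hP] at h1
      have h2 : ((t.natAbs : ℕ) : ℝ) ≤ K := by
        rw [show ((t.natAbs : ℕ) : ℝ) = ((circAbs (K * m i) z : ℤ) : ℝ) by rw [← habs, ← Int.natCast_natAbs, Int.cast_natCast]]
        exact h1.trans hxx
      exact_mod_cast h2
    have hcast : ((t : ℤ) : Fin (K * m i)) = x' i - x i := by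
      rw [ht, hz]
      have h0 : ((K * m i : ℕ) : Fin (K * m i)) = 0 := Fin.natCast_self (K * m i)
      push_cast at h0 ⊢
      rw [h0, zero_mul, add_zero]
    -- the block indices of `x_i` and `x′_i` differ by `0` or `±1` mod `m_i`
    have key : ∀ (a b : Fin (K * m i)), b = a + ((t.natAbs : ℕ) : Fin (K * m i)) →
        circAbs (m i) (((blockIndex K (m i) b : ℕ) : ℤ) - ((blockIndex K (m i) a : ℕ) : ℤ)) ≤ 1 := by
      intro a b hab
      have hMi : 1 ≤ m i := hm i
      rcases blockIndex_add_natCast_of_le K (m i) a htK with h0 | h1'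
      · rw [hab, h0, sub_self, B4Sect5Torus.circAbs_zero]; norm_num
      · rw [hab, h1']
        rcases eq_or_lt_of_le (Nat.succ_le_of_lt (blockIndex K (m i) a).isLt) with hjM | hjM
        · have e1 : blockIndex K (m i) a + 1 = ((((blockIndex K (m i) a : ℕ) + 1 : ℕ)) : Fin (m i)) := by
            rw [Nat.cast_succ, Fin.cast_val_eq_self]
          rw [e1, show (blockIndex K (m i) a : ℕ) + 1 = m i from hjM, Fin.natCast_self, Fin.val_zero]
          have e : ((0 : ℕ) : ℤ) - ((blockIndex K (m i) a : ℕ) : ℤ) = 1 + (m i : ℤ) * (-1) := by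
            have : ((blockIndex K (m i) a : ℕ) : ℤ) + 1 = m i := by exact_mod_cast hjM
            push_cast; linarith
          rw [e, circAbs_add_mul]
          exact (circAbs_le_abs hMi 1).trans (by norm_num)
        · have e1 : blockIndex K (m i) a + 1 = ((((blockIndex K (m i) a : ℕ) + 1 : ℕ)) : Fin (m i)) := by
            rw [Nat.cast_succ, Fin.cast_val_eq_self]
          rw [e1, Fin.val_cast_of_lt hjM]
          have e : ((((blockIndex K (m i) a : ℕ) + 1 : ℕ)) : ℤ) - ((blockIndex K (m i) a : ℕ) : ℤ) = 1 := by push_cast; ring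
          rw [e]
          exact (circAbs_le_abs hMi 1).trans (by norm_num)
    have hc := ccoord_cast hm (blockCoord K m x) (blockCoord K m x') i
    have hbx : (((blockCoord K m x i).val : ℤ)) = ((blockIndex K (m i) (x i) : ℕ) : ℤ) := rfl
    have hbx' : (((blockCoord K m x' i).val : ℤ)) = ((blockIndex K (m i) (x' i) : ℕ) : ℤ) := rfl
    have hMi : 1 ≤ m i := hm i
    rcases Int.natAbs_eq t with h | h
    · -- `x′_i = x_i + |t|`
      have hx' : x' i = x i + ((t.natAbs : ℕ) : Fin (K * m i)) := by
        have : ((t : ℤ) : Fin (K * m i)) = ((t.natAbs : ℕ) : Fin (K * m i)) := by conv_lhs => rw [h]; exact Int.cast_natCast _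
        rw [← this, hcast]; abel
      have := key (x i) (x' i) hx'
      have hsym : circAbs (m i) (((blockIndex K (m i) (x i) : ℕ) : ℤ) - ((blockIndex K (m i) (x' i) : ℕ) : ℤ)) ≤ 1 := by
        rw [show ((blockIndex K (m i) (x i) : ℕ) : ℤ) - ((blockIndex K (m i) (x' i) : ℕ) : ℤ) =
          -(((blockIndex K (m i) (x' i) : ℕ) : ℤ) - ((blockIndex K (m i) (x i) : ℕ) : ℤ)) by ring, B4Sect5Torus.circAbs_neg hMi]
        · exact this
      have h3 : ((ccoord m (blockCoord K m x) (blockCoord K m x') i : ℕ) : ℤ) ≤ 1 := by rw [hc, hbx, hbx']; exact hsym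
      exact_mod_cast h3
    · -- `x_i = x′_i + |t|`
      have hx : x i = x' i + ((t.natAbs : ℕ) : Fin (K * m i)) := by
        have h2 : ((t : ℤ) : Fin (K * m i)) = -((t.natAbs : ℕ) : Fin (K * m i)) := by
          conv_lhs => rw [h]
          rw [Int.cast_neg, Int.cast_natCast]
        have h3 : -(((t.natAbs : ℕ) : Fin (K * m i))) = x' i - x i := by rw [← h2, hcast]
        have := congrArg (fun w => x' i - w) h3
        simp only [sub_neg_eq_add, sub_sub_cancel] at this
        exact this.symm
      have := key (x' i) (x i) hx
      have h3 : ((ccoord m (blockCoord K m x) (blockCoord K m x') i : ℕ) : ℤ) ≤ 1 := by rw [hc, hbx, hbx']; exact this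
      exact_mod_cast h3
  exact_mod_cast h1

end Geometry

/-! ## §2 The localised pieces `λ_y = ζ_y·ω` of a field with weighted value ∕ η-scale Hölder data -/

section Pieces

variable {d : ℕ} (K : ℕ) [NeZero K] (m : Fin d → ℕ) [∀ i, NeZero (m i)] {W : Type*} [NormedAddCommGroup W] [NormedSpace ℂ W]

/-- `u ≤ u^ε` for `0 ≤ u ≤ 1`, `0 < ε ≤ 1` (a Lipschitz quotient at the unit scale is a Hölder quotient). [folklore] -/
private theorem le_rpow_of_le_one {u ε : ℝ} (hu0 : 0 ≤ u) (hu1 : u ≤ 1) (hε1 : ε ≤ 1) : u ≤ u ^ ε := by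
  rcases eq_or_lt_of_le hu0 with h | h
  · rw [← h]; exact Real.rpow_nonneg le_rfl ε
  · conv_lhs => rw [← Real.rpow_one u]
    exact Real.rpow_le_rpow_of_exponent_ge h hu1 hε1

omit [∀ i, NeZero (m i)] in
/-- the weight transfer: `d_m(Πx, y) ≤ c ⟹ e^{−δ·d_m(Πx, v)} ≤ e^{cδ}·e^{−δ·d_m(y, v)}`. [folklore] -/
private theorem weight_transfer (hm : ∀ i, 1 ≤ m i) {δ : ℝ} (hδ : 0 ≤ δ) (px y v : TSite d m) {c : ℝ} (hpy : tdist m px y ≤ c) :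
    Real.exp (-(δ * tdist m px v)) ≤ Real.exp (c * δ) * Real.exp (-(δ * tdist m y v)) := by
  rw [← Real.exp_add]
  refine Real.exp_le_exp.2 ?_
  have h1 := tdist_triangle hm y px v
  rw [tdist_symm hm y px] at h1
  nlinarith [mul_le_mul_of_nonneg_left h1 hδ, mul_le_mul_of_nonneg_left hpy hδ]

/-- **THE LOCALISED PIECES OF A FIELD WITH WEIGHTED VALUE AND η-SCALE HÖLDER DATA.**  On a fine torus `T_P`, `P = (Km)` (the cell's towers via
`siteCast`), let `ω : T_P → W` obey, relative to a coarse centre `v ∈ T_m`, a value row `‖ω(x)‖ ≤ N·e^{−δ d_m(Πx, v)}` and an η-scale Hölder row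
`‖ω(x′) − ω(x)‖ ≤ H·e^{−δ d_m(Πx, v)}·(dist(x,x′)∕K)^ε` on the pairs `dist(x, x′) ≤ K` ((3.40): `|x − x′| ≦ 1` at spacing `η = K⁻¹`), `ε ≤ 1`.  Then the pieces
`λ_y := ζ_y·ω` of the block partition of unity `B9Eq343BlockPartitionOfUnity.blockPartition` (a) sum to `ω`, (b) are supported in the blocks at coarse distance
`≤ 1` from `y` (print's `Δ̃(y)`), (c) obey the value row `‖λ_y(x)‖ ≤ N·e^{δ}·e^{−δ d_m(y, v)}` and (d) the η-scale Hölder row `‖λ_y(x′) − λ_y(x)‖ ≤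
(H + d·N)·e^{2δ}·e^{−δ d_m(y, v)}·(dist(x,x′)∕K)^ε` — the product rule with the unit-scale Lipschitz letter of `ζ_y` (`abs_blockPartition_sub_le`), η-close pairs
lying in adjacent blocks (§1).  This is the localisation step that feeds a BLOCK-LOCALISED Hölder letter (print's (3.44), `supp λ ⊂ Δ̃(y′)`) with a globally
supported input. [folklore] [cite: Balaban1985BackgroundPropagators, (3.43) p.398, (3.44) p.398, (3.40) p.397] -/
theorem localised_pieces {P : Fin d → ℕ} (h : P = fineP K m) (hm : ∀ i, 1 ≤ m i) (ω : TSite d P → W) (v : TSite d m) {N H δ ε : ℝ}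
    (hN : 0 ≤ N) (hH : 0 ≤ H) (hδ : 0 ≤ δ) (hε1 : ε ≤ 1)
    (hval : ∀ x, ‖ω x‖ ≤ N * Real.exp (-(δ * tdist m (blockCoord K m (siteCast h x)) v)))
    (hhol : ∀ x x', tdist P x x' ≤ K →
      ‖ω x' - ω x‖ ≤ H * Real.exp (-(δ * tdist m (blockCoord K m (siteCast h x)) v)) * (tdist P x x' / K) ^ ε) :
    (∀ x, ∑ y, ((blockPartition K m y (siteCast h x) : ℝ) : ℂ) • ω x = ω x) ∧
    (∀ y x, ((blockPartition K m y (siteCast h x) : ℝ) : ℂ) • ω x ≠ 0 → tdist m (blockCoord K m (siteCast h x)) y ≤ 1) ∧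
    (∀ y x, ‖((blockPartition K m y (siteCast h x) : ℝ) : ℂ) • ω x‖ ≤ N * Real.exp δ * Real.exp (-(δ * tdist m y v))) ∧
    (∀ y x x', tdist P x x' ≤ K →
      ‖((blockPartition K m y (siteCast h x') : ℝ) : ℂ) • ω x' - ((blockPartition K m y (siteCast h x) : ℝ) : ℂ) • ω x‖ ≤
        (H + d * N) * Real.exp (2 * δ) * Real.exp (-(δ * tdist m y v)) * (tdist P x x' / K) ^ ε) := by
  have hP : ∀ i, 1 ≤ fineP K m i := fun i => Nat.one_le_iff_ne_zero.2 (Nat.mul_ne_zero (NeZero.ne K) (NeZero.ne (m i)))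
  have hKpos : (0 : ℝ) < K := Nat.cast_pos.2 (Nat.pos_of_ne_zero (NeZero.ne K))
  -- abbreviations
  have hζn : ∀ y z, ‖(((blockPartition K m y z : ℝ)) : ℂ)‖ = blockPartition K m y z := fun y z => by
    rw [Complex.norm_real, Real.norm_eq_abs, abs_of_nonneg (blockPartition_nonneg K m y z)]
  refine ⟨fun x => ?_, fun y x hne => ?_, fun y x => ?_, fun y x x' hxx => ?_⟩
  · -- (a) the pieces sum to `ω`
    rw [← Finset.sum_smul, ← Complex.ofReal_sum, sum_blockPartition, Complex.ofReal_one, one_smul]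
  · -- (b) support
    refine tdist_blockCoord_le_one_of_blockPartition_ne_zero K m hm y (siteCast h x) fun hz => hne ?_
    rw [hz, Complex.ofReal_zero, zero_smul]
  · -- (c) value row
    by_cases hz : blockPartition K m y (siteCast h x) = 0
    · rw [hz, Complex.ofReal_zero, zero_smul, norm_zero]; positivity
    · have hsupp := tdist_blockCoord_le_one_of_blockPartition_ne_zero K m hm y (siteCast h x) hz
      have hw := weight_transfer m hm hδ (blockCoord K m (siteCast h x)) y v hsupp
      rw [one_mul] at hw
      rw [norm_smul, hζn]
      calc blockPartition K m y (siteCast h x) * ‖ω x‖ ≤ 1 * (N * Real.exp (-(δ * tdist m (blockCoord K m (siteCast h x)) v))) :=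
            mul_le_mul (blockPartition_le_one K m y _) (hval x) (norm_nonneg _) zero_le_one
        _ ≤ N * (Real.exp δ * Real.exp (-(δ * tdist m y v))) := by rw [one_mul]; exact mul_le_mul_of_nonneg_left hw hN
        _ = N * Real.exp δ * Real.exp (-(δ * tdist m y v)) := by ring
  · -- (d) the η-scale Hölder row of the piece
    set ζx : ℝ := blockPartition K m y (siteCast h x) with hζx
    set ζx' : ℝ := blockPartition K m y (siteCast h x') with hζx'
    set t : ℝ := tdist P x x' with ht
    set Ex : ℝ := Real.exp (-(δ * tdist m (blockCoord K m (siteCast h x)) v)) with hEx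
    set Ey : ℝ := Real.exp (-(δ * tdist m y v)) with hEy
    have ht0 : 0 ≤ t := tdist_nonneg _ _ _
    have ht0' : 0 ≤ t / K := div_nonneg ht0 hKpos.le
    have htK : t / K ≤ 1 := (div_le_one hKpos).2 hxx
    have hrpow : t / K ≤ (t / K) ^ ε := le_rpow_of_le_one ht0' htK hε1
    have hrpow0 : 0 ≤ (t / K) ^ ε := Real.rpow_nonneg ht0' ε
    have hEx0 : 0 ≤ Ex := Real.exp_nonneg _
    have hEy0 : 0 ≤ Ey := Real.exp_nonneg _
    by_cases hboth : ζx = 0 ∧ ζx' = 0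
    · rw [hboth.1, hboth.2, Complex.ofReal_zero, zero_smul, zero_smul, sub_zero, norm_zero]; positivity
    · -- one of the two cutoff values is nonzero ⇒ `d_m(Πx, y) ≤ 2`
      have hPi2 : tdist m (blockCoord K m (siteCast h x)) y ≤ 2 := by
        rcases not_and_or.1 hboth with hzx | hzx'
        · exact (tdist_blockCoord_le_one_of_blockPartition_ne_zero K m hm y _ hzx).trans (by norm_num)
        · have h1 := tdist_blockCoord_le_one_of_blockPartition_ne_zero K m hm y _ hzx'
          have h2 : tdist m (blockCoord K m (siteCast h x)) (blockCoord K m (siteCast h x')) ≤ 1 :=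
            tdist_blockCoord_le_one_of_tdist_le K m hm _ _ (by rw [tdist_siteCast]; exact hxx)
          have h3 := tdist_triangle hm (blockCoord K m (siteCast h x)) (blockCoord K m (siteCast h x')) y
          linarith
      have hw : Ex ≤ Real.exp (2 * δ) * Ey := weight_transfer m hm hδ (blockCoord K m (siteCast h x)) y v hPi2
      have hlip : |ζx' - ζx| ≤ d * t / K := by
        have := abs_blockPartition_sub_le K m y (siteCast h x) (siteCast h x'); rwa [tdist_siteCast] at this
      have esplit : ((ζx' : ℝ) : ℂ) • ω x' - ((ζx : ℝ) : ℂ) • ω x = ((ζx' : ℝ) : ℂ) • (ω x' - ω x) + (((ζx' - ζx : ℝ)) : ℂ) • ω x := by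
        push_cast; rw [smul_sub, sub_smul]; abel
      rw [esplit]
      refine (norm_add_le _ _).trans ?_
      rw [norm_smul, norm_smul, hζn, Complex.norm_real, Real.norm_eq_abs]
      have h1 : ζx' * ‖ω x' - ω x‖ ≤ 1 * (H * Ex * (t / K) ^ ε) :=
        mul_le_mul (blockPartition_le_one K m y _) (hhol x x' hxx) (norm_nonneg _) zero_le_one
      have h2 : |ζx' - ζx| * ‖ω x‖ ≤ (d * t / K) * (N * Ex) := mul_le_mul hlip (hval x) (norm_nonneg _) (by positivity)
      have h3 : (d * t / K) * (N * Ex) ≤ d * N * Ex * (t / K) ^ ε := by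
        have : (0 : ℝ) ≤ d * N * Ex := by positivity
        calc (d * t / K) * (N * Ex) = d * N * Ex * (t / K) := by ring
          _ ≤ d * N * Ex * (t / K) ^ ε := mul_le_mul_of_nonneg_left hrpow this
      have h4 : (H + d * N) * Ex * (t / K) ^ ε ≤ (H + d * N) * (Real.exp (2 * δ) * Ey) * (t / K) ^ ε :=
        mul_le_mul_of_nonneg_right (mul_le_mul_of_nonneg_left hw (by positivity)) hrpow0
      calc ζx' * ‖ω x' - ω x‖ + |ζx' - ζx| * ‖ω x‖ ≤ 1 * (H * Ex * (t / K) ^ ε) + d * N * Ex * (t / K) ^ ε := add_le_add h1 (h2.trans h3)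
        _ = (H + d * N) * Ex * (t / K) ^ ε := by ring
        _ ≤ (H + d * N) * (Real.exp (2 * δ) * Ey) * (t / K) ^ ε := h4
        _ = (H + d * N) * Real.exp (2 * δ) * Ey * (t / K) ^ ε := by ring

end Pieces

end Literature.MathematicalPhysics.QuantumFieldTheory.Balaban1983to89.B9Eq343BlockLocalisedHolderPieces

end
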